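import Literature.Analysis.FunctionSpaces.TorusMollifierAllOrders
import HarnessLib

/-!
# The Constantin–E–Titi commutator estimate on `T^d` in all `C^N` norms

Analysis/FunctionSpaces support file (serves the discharge of the mollification stage
`Literature.Analysis.FluidPDE.BDSV.mollificationStage`, `FluidPDE/OnsagerBDSVThreeStages`:
Buckmaster–De Lellis–Székelyhidi–Vicol, *Onsager's conjecture for admissible weak solutions*,
CPAM 72 (2019), Prop. A.2 = Prop. 8.2 of arXiv:1701.08678, "the quadratic commutator estimate of
[CET94]" `‖(f*ψ_ℓ)(g*ψ_ℓ) - (fg)*ψ_ℓ‖_r ≤ C ℓ^{2-r} ‖f‖₁ ‖g‖₁`, used in the proof of Prop. 2.2 for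
(2.14)–(2.15)). For the standard mollifier `k_ε = Torus.kernel ε` (`0 < ε ≤ 1/4`), a smooth real
`f` and a smooth vector-valued `k : T^d → F`:

* `Torus.mollCommutator ε f k = k_ε ⋆ (f k) - (k_ε ⋆ f)(k_ε ⋆ k)` (`B_ε(f,k)`, the quantity of the
  Constantin–E–Titi identity (10)) and its unfolding lemma;
* `Torus.mollCommutator_eq_sub_const` — re-centring: the commutator is bilinear and kills
  constants (unit mass), `B_ε(f,k) = B_ε(f - a, k - c)`;
* `Torus.shiftedDerivMass`, `Torus.norm_iteratedFDeriv_lift_kernel_convolution_le_of_apply_eq_zero`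
  — for `g` vanishing at the base point, `‖Dⁱ(lift (k_ε ⋆ g))(x₀)‖ ≤ s_i ε ε^{-i} ‖Dg‖_∞`
  (`i = 0`: `|g| ≤ ε‖Dg‖_∞` on the `ε`-ball, mean value inequality `Torus.norm_lift_sub_apply_sub_le`;
  `i ≥ 1`: one derivative on `g`, the others on the kernel, `TorusMollifierAllOrders`);
* `Torus.commConst d N = c_N + ∑_{i ≤ N} (N choose i) s_i s_{N-i}` and **the estimate**
  `Torus.norm_iteratedFDeriv_lift_mollCommutator_le`:
  `‖D^N (lift B_ε(f,k))(x)‖ ≤ K_N ε² ε^{-N} ‖Df‖_∞ ‖Dk‖_∞` for every `N` and `x` (re-centre at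
  `x`; the mollified product of the two increments is bounded by the local sup
  `(ε‖Df‖)(ε‖Dk‖) · c_N ε^{-N}`, the product of the two mollified increments by the Leibniz rule
  `norm_iteratedFDeriv_smul_le`), with its order-zero case `Torus.norm_mollCommutator_le`
  (`K_0 = 2`);
* pointwise linearity of `θ ⋆ ·` in the smooth factor, vector-valued: `Torus.convolution_sub_right`,
  `Torus.convolution_sub_sub_right`, `Torus.convolution_const_right` (the first and last are used
  here; the three-term form is exported for the mollified momentum equation of
  `FluidPDE/EulerReynoldsMollification`), and `Torus.torusFderiv_sub_const`.

## Design choices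

* Kernel on the left (`kernel ε ⋆ k`, the convention of `TorusConvolution`,
  `TorusSpaceTimeKernel`, `TorusMollifierAllOrders`), and the CET sign `(fg)^ε - f^ε g^ε`
  (BDSV's Prop. A.2 has the opposite sign; immaterial for norms).
* Integer orders `N` only, as pointwise bounds on `D^N` of the lift: the fractional orders
  `N + α` of Prop. A.2 are obtained downstream by interpolation between `N` and `N + 1`
  (`HolderInterpolation.eContDiffHolderNorm_le_of_norm_iteratedFDeriv_le`), which is all the BDSV
  scheme uses. The data entering are the Lipschitz constants `‖Df‖_∞`, `‖Dk‖_∞` instead of the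
  printed `‖f‖₁ ‖g‖₁ ≥ ‖Df‖_∞ ‖Dg‖_∞` — the formal statement is (slightly) stronger than printed,
  which is what the printed proof gives.
* `0 < ε ≤ 1/4` throughout (the torus kernel `Torus.kernel ε` needs `ε ≤ 1/4`); `F` complete where
  Bochner-integral identities with constants are used.

## Mathlib / tree search (what this file does NOT duplicate)

Tree: the CET identity and its `L^{3/2}`/`L³` remainder bounds
`Torus.convolution_mul_sub_mul_convolution`, `Torus.eLpNorm_commutatorRemainder_le`
(`TorusCommutatorEstimate`), the scalar Hölder sup form of the order-zero case
`Torus.abs_commutator_le` (`TorusMollifierHolder`, `f ⋆ kernel ε` convention, constant `2 =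
commConst d 0`), and the Euclidean coarse-graining commutators of `FluidPDE/CoarseGrainingEstimates`;
none of these controls derivatives of the commutator. The linearity lemmas are the vector-valued
versions of `Torus.convolution_sub_right_apply` / `convolution_const_right_apply`
(`FluidPDE/TorusPressurePoisson`, real-valued; a `FunctionSpaces/` file cannot import it);
`θ ⋆ (a • k) = a • θ ⋆ k` is Mathlib's `convolution_smul` and is not restated. Mathlib:
`norm_iteratedFDeriv_smul_le`, `iteratedFDeriv_sub_apply`,
`Convex.norm_image_sub_le_of_norm_fderiv_le`; no commutator estimates (searched `commutator`,
`convolution_mul`).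

## References

* T. Buckmaster, C. De Lellis, L. Székelyhidi Jr., V. Vicol, *Onsager's conjecture for admissible
  weak solutions*, Comm. Pure Appl. Math. 72 (2019) = arXiv:1701.08678, App. A, Prop. A.2
  (= Prop. 8.2 of the arXiv version), and the proof of Prop. 2.2.
* P. Constantin, W. E, E. S. Titi, *Onsager's conjecture on the energy conservation for solutions
  of Euler's equation*, Comm. Math. Phys. 165 (1994), 207–209, (10) (the commutator identity).
* S. Conti, C. De Lellis, L. Székelyhidi Jr., *h-principle and rigidity for `C^{1,α}` isometric
  embeddings*, in: Nonlinear PDE, Abel Symposia 7 (2012), Lemma 1 (the `C^r` commutator estimate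
  BDSV refer to).
-/

noncomputable section

open MeasureTheory TopologicalSpace Set Function Filter Metric ContinuousLinearMap
open scoped ENNReal NNReal Convolution ContDiff Topology

namespace Literature.Analysis.FunctionSpaces

namespace Torus

variable {d : Type*} [Fintype d]
variable {F : Type*} [NormedAddCommGroup F] [NormedSpace ℝ F]

/-! ## Linearity of mollification in the smooth factor -/

section Linearity

variable {θ : UnitAddTorus d → ℝ}

/-- `θ ⋆ (k - k') = θ ⋆ k - θ ⋆ k'` pointwise, for integrable `θ` and continuous `k, k'`. [folklore] -/
theorem convolution_sub_right (hθ : Integrable θ volume) {k k' : UnitAddTorus d → F}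
    (hk : Continuous k) (hk' : Continuous k') (x : UnitAddTorus d) :
    (θ ⋆ fun y => k y - k' y) x = (θ ⋆ k) x - (θ ⋆ k') x := by
  simp only [convolution_lsmul, smul_sub]
  exact integral_sub (integrable_smul_comp_sub hθ hk x) (integrable_smul_comp_sub hθ hk' x)

/-- `θ ⋆ (k - k' - k'') = θ ⋆ k - θ ⋆ k' - θ ⋆ k''` pointwise (integrable `θ`, continuous
`k, k', k''`). [folklore] -/
theorem convolution_sub_sub_right (hθ : Integrable θ volume) {k k' k'' : UnitAddTorus d → F}
    (hk : Continuous k) (hk' : Continuous k') (hk'' : Continuous k'') (x : UnitAddTorus d) :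
    (θ ⋆ fun y => k y - k' y - k'' y) x = (θ ⋆ k) x - (θ ⋆ k') x - (θ ⋆ k'') x := by
  simp only [convolution_lsmul, smul_sub]
  rw [integral_sub ?_ (integrable_smul_comp_sub hθ hk'' x),
    integral_sub (integrable_smul_comp_sub hθ hk x) (integrable_smul_comp_sub hθ hk' x)]
  exact (integrable_smul_comp_sub hθ hk x).sub (integrable_smul_comp_sub hθ hk' x)

/-- `θ ⋆ c = (∫ θ) • c` for a constant `c` (complete `F`: a Bochner integral identity). [folklore] -/
theorem convolution_const_right [CompleteSpace F] (θ : UnitAddTorus d → ℝ) (c : F) (x : UnitAddTorus d) :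
    (θ ⋆ fun _ => c) x = (∫ y, θ y) • c := by
  simp only [convolution_lsmul, integral_smul_const]

end Linearity

/-! ## The commutator and its re-centring -/

section Commutator

variable {ε : ℝ}

/-- **The Constantin–E–Titi commutator** of mollification at scale `ε` with the product of a
real function `f` and a vector-valued `k` on `T^d`:
`B_ε(f, k) = k_ε ⋆ (f k) - (k_ε ⋆ f)(k_ε ⋆ k)` (Constantin–E–Titi 1994, (10):
`(fg)^ε - f^ε g^ε`; Buckmaster–De Lellis–Székelyhidi–Vicol, Prop. A.2 (with the opposite sign)).
[cite: ConstantinETiti1994, (10)] -/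
def mollCommutator (ε : ℝ) (f : UnitAddTorus d → ℝ) (k : UnitAddTorus d → F) :
    UnitAddTorus d → F :=
  fun x => (kernel ε ⋆ fun y => f y • k y) x - (kernel ε ⋆ f) x • (kernel ε ⋆ k) x

/-- Unfolding lemma for `mollCommutator`. [folklore] -/
theorem mollCommutator_apply (ε : ℝ) (f : UnitAddTorus d → ℝ) (k : UnitAddTorus d → F)
    (x : UnitAddTorus d) :
    mollCommutator ε f k x = (kernel ε ⋆ fun y => f y • k y) x - (kernel ε ⋆ f) x • (kernel ε ⋆ k) x :=
  rfl

/-- **Re-centring**: the commutator is bilinear and kills constants (unit mass of `k_ε`), hence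
`B_ε(f, k) = B_ε(f - a, k - c)` for all constants `a ∈ ℝ`, `c ∈ F` (`0 < ε ≤ 1/4`). [folklore] -/
theorem mollCommutator_eq_sub_const [CompleteSpace F] (hε : 0 < ε) (hε' : ε ≤ 1 / 4) {f : UnitAddTorus d → ℝ}
    (hf : Continuous f) {k : UnitAddTorus d → F} (hk : Continuous k) (a : ℝ) (c : F) :
    mollCommutator ε f k = mollCommutator ε (fun y => f y - a) (fun y => k y - c) := by
  have hκc : Continuous (kernel (d := d) ε) := continuous_kernel hε hε'
  have hκ : Integrable (kernel (d := d) ε) volume := hκc.integrable_unitAddTorus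
  have h1 : ∫ y, kernel (d := d) ε y = 1 := integral_kernel hε hε'
  funext x
  simp only [mollCommutator_apply]
  have hfx : Continuous fun t => f (x - t) := hf.comp (continuous_const.sub continuous_id)
  have hkx : Continuous fun t => k (x - t) := hk.comp (continuous_const.sub continuous_id)
  -- `k_ε ⋆ ((f - a)(k - c)) = k_ε ⋆ (fk) - (k_ε ⋆ f) c - a (k_ε ⋆ k) + a c`
  have e1 : (kernel ε ⋆ fun y => (f y - a) • (k y - c)) x =
      (kernel ε ⋆ fun y => f y • k y) x - (kernel ε ⋆ f) x • c - a • (kernel ε ⋆ k) x + a • c := by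
    simp only [convolution_lsmul]
    have I1 : Integrable (fun t => kernel ε t • (f (x - t) • k (x - t))) volume :=
      (hκc.smul (hfx.smul hkx)).integrable_unitAddTorus
    have I2 : Integrable (fun t => (kernel ε t • f (x - t)) • c) volume :=
      ((hκc.smul hfx).smul continuous_const).integrable_unitAddTorus
    have I3 : Integrable (fun t => a • (kernel ε t • k (x - t))) volume :=
      ((hκc.smul hkx).const_smul a).integrable_unitAddTorus
    have I4 : Integrable (fun t => kernel ε t • (a • c)) volume :=
      (hκc.smul continuous_const).integrable_unitAddTorus
    have hpt : (fun t => kernel ε t • ((f (x - t) - a) • (k (x - t) - c))) = fun t =>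
        kernel ε t • (f (x - t) • k (x - t)) - (kernel ε t • f (x - t)) • c -
          a • (kernel ε t • k (x - t)) + kernel ε t • (a • c) := by
      funext t
      rw [smul_assoc, smul_comm a (kernel ε t) (k (x - t))]
      simp only [sub_smul, smul_sub]
      abel
    rw [hpt, integral_add ?_ I4, integral_sub ?_ I3, integral_sub I1 I2,
      integral_smul_const, integral_smul, integral_smul_const, h1, one_smul]
    · exact I1.sub I2
    · exact (I1.sub I2).sub I3
  -- `k_ε ⋆ (f - a) = k_ε ⋆ f - a`, `k_ε ⋆ (k - c) = k_ε ⋆ k - c`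
  have e2 : (kernel ε ⋆ fun y => f y - a) x = (kernel ε ⋆ f) x - (kernel ε ⋆ fun _ => a) x :=
    convolution_sub_right hκ hf continuous_const x
  have e3 : (kernel ε ⋆ fun y => k y - c) x = (kernel ε ⋆ k) x - (kernel ε ⋆ fun _ => c) x :=
    convolution_sub_right hκ hk continuous_const x
  rw [e1, e2, e3, convolution_const_right, convolution_const_right, h1, one_smul, one_smul]
  simp only [sub_smul, smul_sub]
  abel

/-- The commutator of smooth functions is smooth (`0 < ε ≤ 1/4`). [folklore] -/
theorem isSmooth_mollCommutator (hε : 0 < ε) (hε' : ε ≤ 1 / 4) {f : UnitAddTorus d → ℝ}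
    (hf : IsSmooth f) {k : UnitAddTorus d → F} (hk : IsSmooth k) :
    IsSmooth (mollCommutator ε f k) := by
  have hκ : Integrable (kernel (d := d) ε) volume := (continuous_kernel hε hε').integrable_unitAddTorus
  exact (isSmooth_convolution hκ (hf.smul' hk)).sub
    ((isSmooth_convolution hκ hf).smul' (isSmooth_convolution hκ hk))

end Commutator

/-! ## Increments and re-centred mollifications -/

section Increments

/-- Increments of a `C¹` function on the torus along a Euclidean displacement of the lift:
`‖f (proj (x - w)) - f (proj x)‖ ≤ ‖Df‖_∞ ‖w‖` (mean value inequality in `ℝ^d`). [folklore] -/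
theorem norm_lift_sub_apply_sub_le {f : UnitAddTorus d → F} (hf : IsContDiff 1 f) {A : ℝ}
    (hA : ∀ y, ‖Torus.fderiv f y‖ ≤ A) (x w : EuclideanSpace ℝ d) :
    ‖lift f (x - w) - lift f x‖ ≤ A * ‖w‖ := by
  have hd : ∀ y ∈ (univ : Set (EuclideanSpace ℝ d)), DifferentiableAt ℝ (lift f) y :=
    fun y _ => (ContDiff.differentiable hf one_ne_zero y)
  have hb : ∀ y ∈ (univ : Set (EuclideanSpace ℝ d)), ‖_root_.fderiv ℝ (lift f) y‖ ≤ A :=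
    fun y _ => by rw [fderiv_lift]; exact hA _
  have h := Convex.norm_image_sub_le_of_norm_fderiv_le hd hb convex_univ (mem_univ x)
    (mem_univ (x - w))
  rwa [sub_sub_cancel_left, norm_neg] at h

/-- The torus derivative is unchanged by subtracting a constant. [folklore] -/
theorem torusFderiv_sub_const (f : UnitAddTorus d → F) (c : F) (x : UnitAddTorus d) :
    Torus.fderiv (fun y => f y - c) x = Torus.fderiv f x := by
  unfold Torus.fderiv
  exact fderiv_sub_const c

variable (d) in
/-- The constants `s_i` in `‖D^i (k_ε ⋆ g)(x₀)‖ ≤ s_i ε^{1-i} ‖Dg‖_∞` for `g` vanishing at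
`proj x₀`: `s_0 = c_0 (= 1)` (local sup bound) and `s_{j+1} = c_j` (one derivative on `g`). [folklore] -/
def shiftedDerivMass : ℕ → ℝ
  | 0 => derivProfileMass d 0
  | j + 1 => derivProfileMass d j

/-- `s_i ≥ 0`. [folklore] -/
theorem shiftedDerivMass_nonneg : ∀ i, 0 ≤ shiftedDerivMass d i
  | 0 => derivProfileMass_nonneg 0
  | j + 1 => derivProfileMass_nonneg j

variable {ε : ℝ}

/-- **Derivatives of the mollification of a function vanishing at the base point**: if `g` is
smooth with `‖Dg‖ ≤ A` and `g (proj x₀) = 0`, then `‖D^i (lift (k_ε ⋆ g))(x₀)‖ ≤ s_i ε ε^{-i} A`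
for every `i` (`i = 0`: `|g| ≤ A ε` on the `ε`-ball; `i ≥ 1`: one derivative on `g`, the others
on the kernel). [folklore] -/
theorem norm_iteratedFDeriv_lift_kernel_convolution_le_of_apply_eq_zero (hε : 0 < ε)
    (hε' : ε ≤ 1 / 4) {g : UnitAddTorus d → F} (hg : IsSmooth g) {A : ℝ}
    (hA : ∀ y, ‖Torus.fderiv g y‖ ≤ A) (x₀ : EuclideanSpace ℝ d) (hg0 : g (proj x₀) = 0) :
    ∀ i : ℕ, ‖iteratedFDeriv ℝ i (lift (kernel ε ⋆ g)) x₀‖ ≤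
      shiftedDerivMass d i * (ε * (ε ^ i)⁻¹) * A
  | 0 => by
    have h := norm_iteratedFDeriv_lift_kernel_convolution_le hε hε' hg 0 x₀ (A := A * ε)
      (fun z hz => by
        have h1 := norm_lift_sub_apply_sub_le (hg.isContDiff (by simp)) hA x₀ (reprc z)
        rw [lift_apply, lift_apply, proj_sub, proj_reprc, hg0, sub_zero] at h1
        have hA0 : 0 ≤ A := (norm_nonneg _).trans (hA 0)
        exact h1.trans (mul_le_mul_of_nonneg_left hz hA0))
    simpa [shiftedDerivMass, mul_comm, mul_left_comm, mul_assoc] using h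
  | j + 1 => by
    have h := norm_iteratedFDeriv_succ_lift_kernel_convolution_le hε hε' hg j x₀ hA
    have he : shiftedDerivMass d (j + 1) * (ε * (ε ^ (j + 1))⁻¹) * A =
        derivProfileMass d j * (ε ^ j)⁻¹ * A := by
      simp only [shiftedDerivMass]
      rw [pow_succ, mul_inv, mul_comm (ε ^ j)⁻¹ ε⁻¹, ← mul_assoc ε, mul_inv_cancel₀ hε.ne', one_mul]
    rw [he]
    exact h

end Increments

/-! ## The commutator estimate in `C^N` -/

section Estimate

variable (d) in
/-- The constant `K_N = c_N + ∑_{i ≤ N} (N choose i) s_i s_{N-i}` of the `C^N` commutator estimate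
`‖D^N B_ε(f, k)‖ ≤ K_N ε^{2-N} ‖Df‖_∞ ‖Dk‖_∞`. [folklore] -/
def commConst (N : ℕ) : ℝ :=
  derivProfileMass d N +
    ∑ i ∈ Finset.range (N + 1), (N.choose i : ℝ) * shiftedDerivMass d i * shiftedDerivMass d (N - i)

/-- `K_N ≥ 0`. [folklore] -/
theorem commConst_nonneg (N : ℕ) : 0 ≤ commConst d N :=
  add_nonneg (derivProfileMass_nonneg N) (Finset.sum_nonneg fun i _ =>
    mul_nonneg (mul_nonneg (Nat.cast_nonneg _) (shiftedDerivMass_nonneg i))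
      (shiftedDerivMass_nonneg _))

/-- `c_N ≤ K_N`. [folklore] -/
theorem derivProfileMass_le_commConst (N : ℕ) : derivProfileMass d N ≤ commConst d N :=
  le_add_of_nonneg_right (Finset.sum_nonneg fun i _ =>
    mul_nonneg (mul_nonneg (Nat.cast_nonneg _) (shiftedDerivMass_nonneg i))
      (shiftedDerivMass_nonneg _))

variable {ε : ℝ}

/-- **The Constantin–E–Titi / Conti–De Lellis–Székelyhidi commutator estimate in `C^N`**
(Buckmaster–De Lellis–Székelyhidi–Vicol, Prop. A.2: `‖(f*ψ_ℓ)(g*ψ_ℓ) - (fg)*ψ_ℓ‖_r ≤ C ℓ^{2-r} ‖f‖_1 ‖g‖_1`,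
integer orders `r = N`, with `‖·‖_1` replaced by the Lipschitz data `‖Df‖_∞, ‖Dk‖_∞` which is all
the proof uses): for smooth `f : T^d → ℝ`, `k : T^d → F` with `‖Df‖ ≤ A_f`, `‖Dk‖ ≤ A_k` and
`0 < ε ≤ 1/4`, `‖D^N (lift B_ε(f,k))(x)‖ ≤ K_N ε² ε^{-N} A_f A_k` for every `N` and `x`.
Proof: re-centre at `x` (`B_ε(f,k) = B_ε(f - f(x), k - k(x))`), bound `D^N` of
`k_ε ⋆ ((f - f(x))(k - k(x)))` by the local sup `A_f ε · A_k ε` on the `ε`-ball, and `D^N` of the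
product `(k_ε ⋆ (f - f(x))) (k_ε ⋆ (k - k(x)))` by the Leibniz rule and
`norm_iteratedFDeriv_lift_kernel_convolution_le_of_apply_eq_zero`.
[cite: BuckmasterEtAl2018, Prop. A.2] -/
theorem norm_iteratedFDeriv_lift_mollCommutator_le [CompleteSpace F] (hε : 0 < ε) (hε' : ε ≤ 1 / 4)
    {f : UnitAddTorus d → ℝ} (hf : IsSmooth f) {k : UnitAddTorus d → F} (hk : IsSmooth k)
    {Af Ak : ℝ} (hAf : ∀ y, ‖Torus.fderiv f y‖ ≤ Af) (hAk : ∀ y, ‖Torus.fderiv k y‖ ≤ Ak)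
    (N : ℕ) (x : EuclideanSpace ℝ d) :
    ‖iteratedFDeriv ℝ N (lift (mollCommutator ε f k)) x‖ ≤
      commConst d N * (ε ^ 2 * (ε ^ N)⁻¹) * Af * Ak := by
  have hκ : Integrable (kernel (d := d) ε) volume := (continuous_kernel hε hε').integrable_unitAddTorus
  have hAf0 : 0 ≤ Af := (norm_nonneg _).trans (hAf 0)
  have hAk0 : 0 ≤ Ak := (norm_nonneg _).trans (hAk 0)
  -- re-centre at `x`
  set a : ℝ := f (proj x) with ha
  set c : F := k (proj x) with hc
  set f₀ : UnitAddTorus d → ℝ := fun y => f y - a with hf₀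
  set k₀ : UnitAddTorus d → F := fun y => k y - c with hk₀
  have hf₀s : IsSmooth f₀ := hf.sub (isSmooth_const a)
  have hk₀s : IsSmooth k₀ := hk.sub (isSmooth_const c)
  have hAf₀ : ∀ y, ‖Torus.fderiv f₀ y‖ ≤ Af := fun y => by rw [hf₀, torusFderiv_sub_const]; exact hAf y
  have hAk₀ : ∀ y, ‖Torus.fderiv k₀ y‖ ≤ Ak := fun y => by rw [hk₀, torusFderiv_sub_const]; exact hAk y
  have hf₀0 : f₀ (proj x) = 0 := sub_self _
  have hk₀0 : k₀ (proj x) = 0 := sub_self _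
  rw [mollCommutator_eq_sub_const hε hε' hf.continuous hk.continuous a c]
  -- split the commutator
  have hP : IsSmooth (kernel ε ⋆ fun y => f₀ y • k₀ y) := isSmooth_convolution hκ (hf₀s.smul' hk₀s)
  have hΦ : IsSmooth (kernel ε ⋆ f₀) := isSmooth_convolution hκ hf₀s
  have hΨ : IsSmooth (kernel ε ⋆ k₀) := isSmooth_convolution hκ hk₀s
  have hsplit : lift (mollCommutator ε f₀ k₀) =
      lift (kernel ε ⋆ fun y => f₀ y • k₀ y) - fun y => lift (kernel ε ⋆ f₀) y • lift (kernel ε ⋆ k₀) y := by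
    funext y; rfl
  have hPN : ContDiffAt ℝ N (lift (kernel ε ⋆ fun y => f₀ y • k₀ y)) x :=
    (hP.of_le (by exact_mod_cast le_top)).contDiffAt
  have hSN : ContDiffAt ℝ N (fun y => lift (kernel ε ⋆ f₀) y • lift (kernel ε ⋆ k₀) y) x :=
    ((ContDiff.smul hΦ hΨ).of_le (by exact_mod_cast le_top)).contDiffAt
  rw [hsplit, iteratedFDeriv_sub_apply hPN hSN]
  refine (norm_sub_le _ _).trans ?_
  -- Term 1: local sup bound
  have h1 : ‖iteratedFDeriv ℝ N (lift (kernel ε ⋆ fun y => f₀ y • k₀ y)) x‖ ≤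
      derivProfileMass d N * (ε ^ N)⁻¹ * (Af * ε * (Ak * ε)) := by
    refine norm_iteratedFDeriv_lift_kernel_convolution_le hε hε' (hf₀s.smul' hk₀s) N x fun z hz => ?_
    have hfz := norm_lift_sub_apply_sub_le (hf₀s.isContDiff (by simp)) hAf₀ x (reprc z)
    have hkz := norm_lift_sub_apply_sub_le (hk₀s.isContDiff (by simp)) hAk₀ x (reprc z)
    rw [lift_apply, lift_apply, proj_sub, proj_reprc] at hfz hkz
    rw [hf₀0, sub_zero] at hfz
    rw [hk₀0, sub_zero] at hkz
    simp only [norm_smul]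
    exact mul_le_mul (hfz.trans (mul_le_mul_of_nonneg_left hz hAf0))
      (hkz.trans (mul_le_mul_of_nonneg_left hz hAk0)) (norm_nonneg _) (by positivity)
  -- Term 2: Leibniz
  have h2 : ‖iteratedFDeriv ℝ N (fun y => lift (kernel ε ⋆ f₀) y • lift (kernel ε ⋆ k₀) y) x‖ ≤
      ∑ i ∈ Finset.range (N + 1), (N.choose i : ℝ) *
        (shiftedDerivMass d i * (ε * (ε ^ i)⁻¹) * Af) *
        (shiftedDerivMass d (N - i) * (ε * (ε ^ (N - i))⁻¹) * Ak) := by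
    refine (norm_iteratedFDeriv_smul_le (𝕜 := ℝ) (N := ∞) hΦ hΨ x (n := N)
      (by exact_mod_cast le_top)).trans ?_
    refine Finset.sum_le_sum fun i hi => ?_
    rw [mul_assoc, mul_assoc]
    refine mul_le_mul_of_nonneg_left ?_ (Nat.cast_nonneg _)
    exact mul_le_mul
      (norm_iteratedFDeriv_lift_kernel_convolution_le_of_apply_eq_zero hε hε' hf₀s hAf₀ x hf₀0 i)
      (norm_iteratedFDeriv_lift_kernel_convolution_le_of_apply_eq_zero hε hε' hk₀s hAk₀ x hk₀0 _)
      (norm_nonneg _) (mul_nonneg (mul_nonneg (shiftedDerivMass_nonneg i) (by positivity)) hAf0)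
  -- algebra: `ε^{-i} ε^{-(N-i)} = ε^{-N}`
  have hpow : ∀ i ∈ Finset.range (N + 1), (ε * (ε ^ i)⁻¹) * (ε * (ε ^ (N - i))⁻¹) =
      ε ^ 2 * (ε ^ N)⁻¹ := by
    intro i hi
    have hiN : i ≤ N := Nat.lt_succ_iff.1 (Finset.mem_range.1 hi)
    rw [show ε ^ N = ε ^ i * ε ^ (N - i) by rw [← pow_add, Nat.add_sub_cancel' hiN], mul_inv]
    field_simp
  have h2' : ∑ i ∈ Finset.range (N + 1), (N.choose i : ℝ) *
        (shiftedDerivMass d i * (ε * (ε ^ i)⁻¹) * Af) *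
        (shiftedDerivMass d (N - i) * (ε * (ε ^ (N - i))⁻¹) * Ak) =
      (∑ i ∈ Finset.range (N + 1),
        (N.choose i : ℝ) * shiftedDerivMass d i * shiftedDerivMass d (N - i)) *
        (ε ^ 2 * (ε ^ N)⁻¹) * Af * Ak := by
    rw [Finset.sum_mul, Finset.sum_mul, Finset.sum_mul]
    refine Finset.sum_congr rfl fun i hi => ?_
    rw [← hpow i hi]
    ring
  rw [h2'] at h2
  calc _ ≤ derivProfileMass d N * (ε ^ N)⁻¹ * (Af * ε * (Ak * ε)) +
        (∑ i ∈ Finset.range (N + 1),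
          (N.choose i : ℝ) * shiftedDerivMass d i * shiftedDerivMass d (N - i)) *
          (ε ^ 2 * (ε ^ N)⁻¹) * Af * Ak := add_le_add h1 h2
    _ = commConst d N * (ε ^ 2 * (ε ^ N)⁻¹) * Af * Ak := by
        rw [commConst]
        ring

/-- The commutator itself: `‖B_ε(f,k)(z)‖ ≤ K_0 ε² A_f A_k`, the case `r = 0` of BDSV's
Prop. A.2 (`N = 0` above; `K_0 = commConst d 0 = 2`, the same constant as in the tree's scalar
Hölder sup form `Torus.abs_commutator_le` of `TorusMollifierHolder`, stated there in the
`f ⋆ kernel ε` convention). [cite: BuckmasterEtAl2018, Prop. A.2] -/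
theorem norm_mollCommutator_le [CompleteSpace F] (hε : 0 < ε) (hε' : ε ≤ 1 / 4) {f : UnitAddTorus d → ℝ}
    (hf : IsSmooth f) {k : UnitAddTorus d → F} (hk : IsSmooth k) {Af Ak : ℝ}
    (hAf : ∀ y, ‖Torus.fderiv f y‖ ≤ Af) (hAk : ∀ y, ‖Torus.fderiv k y‖ ≤ Ak) (z : UnitAddTorus d) :
    ‖mollCommutator ε f k z‖ ≤ commConst d 0 * ε ^ 2 * Af * Ak := by
  obtain ⟨x, rfl⟩ := proj_surjective z
  have h := norm_iteratedFDeriv_lift_mollCommutator_le hε hε' hf hk hAf hAk 0 x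
  rw [norm_iteratedFDeriv_zero, lift_apply, pow_zero, inv_one, mul_one] at h
  exact h

end Estimate

end Torus

end Literature.Analysis.FunctionSpaces
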